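import Summits.BirchSwinnertonDyer.BirchSwinnertonDyer.Theorems.AlignedTransportAtTwoMainConjectureTransportAlignedAtTwoKilfordKernelLetterCrossLevelIhara
import HarnessLib

/-!
# Crux C1 `MainConjectureTransportAlignedAtTwo` (stmt-BirchSwinnertonDyer-22296), line `birth`, residual (R2) `stub_lamLawKilford` (Kilford stratum),
# UNEQUAL conductors: the IHARA STEP for (r5) along a chain of old lines — «non-vanishing of the half-class functional survives `g ↦ g + q·g(q·)`» for ANY
# lattice-compatible `T_ℓ`-eigenform `g`, not only a newform (width seat att-p4 g18; `--supports 22296`)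

THEOREMS ONLY (no `def`, no `sorry`, no instance); CONDITIONAL on the PRINT named fact `ihara_periodHomology_mod_eisenstein` (Literature, this seat). BSD is not proved
by this; C1 is not closed by this.

att-p3 g18 reduces the squarefree-ratio shapes `N(W₂) = N(W₁)·∏_{q∈Q} q` through the ITERATED old lines `F_Q = ∏_{q∈Q}(1 + q·ι_q) f₁` (`…CrossLevelSquarefree.oldLines_absorb`,
`…CrossLevelOldLinesHecke`: `T_p F_Q = a_p(W₁) F_Q` for `p ∉ Q`). Row (r5) for `F_Q` — its half-class functional is non-zero — follows by INDUCTION on `Q` from the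
one-prime Ihara step, provided the step is stated for an arbitrary form: **`exists_uniformize_oldLine_half_ne_zero_of_form`** — for `g ∈ S₂(Γ₀(N₁))` with
`c·φ(g) ∈ Λ_W` on `H₁(X₀(N₁);ℤ)`, `T_ℓ g = a_ℓ(W) g` for the primes `ℓ ∤ N₂ = N₁q`, `W` without rational `2`-torsion abscissa, and `F ∈ S₂(Γ₀(N₂))` with
`a_n(F) = a_n(g) + q·a_{n/q}(g)`: if `u_W(c·x(g)/2) ≠ O` for some `x ∈ H₁(X₀(N₁);ℤ)` then `u_W(c·y(F)/2) ≠ O` for some `y ∈ H₁(X₀(N₂);ℤ)`. The proof is that of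
`…CrossLevelIhara.exists_jacobiMapForm_oldLine_half_ne_zero` with the newform replaced by `g` (Ihara with `(a, b) = (x, 0)` at a prime `ℓ` with `a_ℓ(W) − ℓ − 1` odd).
The base of the induction is the newform level (`…CrossLevelCarrierLift.exists_jacobiMap_half_ne_zero_of_lift`); the lattice condition and the eigen-property of
`F_Q` at the next level are att-p3 g18's `mul_apply_oldLines_mem` / `…OldLinesHecke`.

References: [DarmonDiamondTaylor1995, Lemma 4.28 (a) (p. 135), Lemma 4.30 (b) (p. 136), Prop. 2.6 (b)]; [Ribet1990, Thm. 4.1]; [DiamondShurman2005, §5.7];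
[CremonaAlgorithms1997, §2.4, §2.10].
-/

set_option autoImplicit false

noncomputable section

-- justification: the `Summit.BirchSwinnertonDyer.BirchSwinnertonDyer.…` path repeats a component (route-file convention)
set_option linter.dupNamespace false

open scoped MatrixGroups ModularForm NumberField Classical
open CongruenceSubgroup Polynomial WeierstrassCurve NumberField IsDedekindDomain Field Module
open Literature.NumberTheory.EllipticCurves Literature.NumberTheory.EllipticCurves.ModularForms
open Literature.NumberTheory.EllipticCurves.Greenberg1999
open Summit.BirchSwinnertonDyer.Rank1Residual Summit.BirchSwinnertonDyer.Rank1Residual.F1Sign2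
open Summit.BirchSwinnertonDyer.BirchSwinnertonDyer.Theorems.AlignedTransportAtTwoKilfordCopyCrossLevelHecke

namespace Summit.BirchSwinnertonDyer.BirchSwinnertonDyer.Theorems.AlignedTransportAtTwoKilfordKernelLetterCrossLevelIharaStep

/-- **The Ihara step for (r5), for an arbitrary lattice-compatible eigenform.** See the module docstring. [cite: DarmonDiamondTaylor1995, Lemma 4.28 (a) (p. 135) and Prop. 2.6 (b)]
[cite: Ribet1990, Thm. 4.1] [cite: DiamondShurman2005, §5.7] -/
theorem exists_uniformize_oldLine_half_ne_zero_of_form (hIh : ihara_periodHomology_mod_eisenstein)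
    (W : WeierstrassCurve ℚ) [W.IsElliptic] [W.IsGloballyMinimal] (ht : ∀ x : ℚ, ¬ HasRationalTwoTorsionX W x)
    {N₀ N₁ N₂ q : ℕ} [NeZero N₀] [NeZero N₁] [NeZero N₂] [NeZero q] (hq : q.Prime) (hqN₁ : ¬ q ∣ N₁) (hN₂ : N₂ = N₁ * q)
    (D : ModularParametrizationData W N₀) (g : CuspForm (Gamma0 N₁) 2)
    (hgΛ : ∀ φ ∈ periodHomology N₁, (D.c : ℂ) * φ g ∈ D.L.lattice)
    (hTg : ∀ (ℓ : ℕ) [NeZero ℓ], ℓ.Prime → ¬ ℓ ∣ N₂ → heckeT (Gamma0 N₁) 2 ℓ g = ((W.LFunction ℓ : ℤ) : ℂ) • g)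
    (F : CuspForm (Gamma0 N₂) 2)
    (hF : ∀ n : ℕ, cuspCoeff F n = cuspCoeff g n + (q : ℂ) * (if q ∣ n then cuspCoeff g (n / q) else 0))
    (hnz : ∃ x ∈ periodHomology N₁, D.uniformize ((D.c : ℂ) * x g / 2) ≠ 0) :
    ∃ y ∈ periodHomology N₂, D.uniformize ((D.c : ℂ) * y F / 2) ≠ 0 := by
  have h₁ : N₁ * 1 ∣ N₂ := by rw [mul_one, hN₂]; exact dvd_mul_right _ _
  have hq' : N₁ * q ∣ N₂ := by rw [hN₂]
  have hN₂0 : N₂ ≠ 0 := NeZero.ne N₂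
  -- a good odd prime `ℓ ∤ N₂` with `a_ℓ(W) − ℓ − 1` odd
  have hirr := Summit.BirchSwinnertonDyer.BirchSwinnertonDyer.Theorems.AlignedTransportAtTwoSeed.irr_two_of_forall_not_hasRationalTwoTorsionX W ht
  obtain ⟨ℓ, hℓF, hℓS, -, hgood, hodd⟩ :=
    exists_prime_notMem_not_dvd_frobeniusTrace_sub W 2 hirr (↑N₂.primeFactors : Set ℕ) (Finset.finite_toSet _)
  have hℓ : ℓ.Prime := hℓF.out
  haveI : NeZero ℓ := ⟨hℓ.ne_zero⟩
  have hℓN₂ : ¬ ℓ ∣ N₂ := fun h => hℓS (Finset.mem_coe.mpr (Nat.mem_primeFactors.mpr ⟨hℓ, h, hN₂0⟩))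
  obtain ⟨k, hk⟩ : Odd (W.LFunction ℓ - ((ℓ : ℤ) + 1)) := by
    rw [LFunction_apply_prime_eq_frobeniusTrace W ℓ hgood]
    exact Int.not_even_iff_odd.mp fun h => hodd (even_iff_two_dvd.mp h)
  have hT := hTg ℓ hℓ hℓN₂
  -- suppose every half-class is killed at level `N₂`
  obtain ⟨x, hx, hxne⟩ := hnz
  by_contra hall
  push Not at hall
  -- Ihara with `(a, b) = (x, 0)`
  obtain ⟨y, hy, hyα, hyβ⟩ := hIh N₁ q hq hqN₁ N₂ h₁ hq' hN₂ ℓ hℓ hℓN₂ x hx 0 (periodHomology N₁).zero_mem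
  have hβ : (q : ℂ) * y (iota N₁ N₂ q 2 hq' g) = 0 := by
    rw [hyβ g, LinearMap.zero_apply, LinearMap.zero_apply, mul_zero, sub_zero]
  -- `y(F) = (a_ℓ − ℓ − 1)·x(g)`
  have hyF : y F = (((W.LFunction ℓ - ((ℓ : ℤ) + 1) : ℤ)) : ℂ) * x g := by
    rw [oldLine_eq h₁ hq' g F hF, map_add, map_smul, smul_eq_mul, hβ, add_zero, hyα g, hT, map_smul, smul_eq_mul]
    push_cast
    ring
  have hxΛ : (D.c : ℂ) * x g ∈ D.L.lattice := hgΛ x hx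
  have hyΛ : (D.c : ℂ) * y F / 2 ∈ D.L.lattice := by
    have h := hall y hy
    rw [D.uniformize_eq_zero_iff] at h
    exact h
  have hhalf : (D.c : ℂ) * x g / 2 ∈ D.L.lattice := by
    have hsplit : (D.c : ℂ) * x g / 2 = (D.c : ℂ) * y F / 2 - (k : ℂ) * ((D.c : ℂ) * x g) := by
      rw [hyF, hk]; push_cast; ring
    rw [hsplit]
    refine D.L.lattice.sub_mem hyΛ ?_
    rw [← zsmul_eq_mul]
    exact D.L.lattice.smul_mem k hxΛ
  exact hxne ((D.uniformize_eq_zero_iff _).mpr hhalf)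

end Summit.BirchSwinnertonDyer.BirchSwinnertonDyer.Theorems.AlignedTransportAtTwoKilfordKernelLetterCrossLevelIharaStep

end
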